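import Summits.ResolutionOfSingularities.ResolutionOfSingularities.Theorems.FrobeniusLadderFInjectiveMacaulayficationX2Cubic4SingularCentre
import HarnessLib

/-!
# T-side CLASS ROUTE, scheme level: the singular centre `𝓚_Σ = vanishingIdeal (Reg Y₁)ᶜ` on the point blow-up `Y₁ = Bl_𝔪 Y` of ANY isolated prime hypersurface germ at the origin —
# the two binders of `TStepGerm.tStepInstanceAt_of_isBlowup` under HYPOTHESES (`f` prime, no constant term, `f ∉ (X₀)`, `Y` regular off the origin), bed-free
# (crux `FInjectiveMacaulayfication` stmt-ResolutionOfSingularities-15315, chain w45a; generalises res-L1-w45a-lead-1 g11's ✓ `X2Cubic4SingularCentre` / g7's `E4GermSingularCentre`;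
# seat res-L1-w45a-lead-1 g11)

[OURS · L1 W4.5a] Support file (`--supports stmt-ResolutionOfSingularities-15315 --as helper`); def-free; UNCONDITIONAL; no named fact; NOT a statement of any manuscript. AI-written
(AI review is weaker than expert review).

`Y = Spec k[X₀..X_{n-1}]/(f)` (`n = 5` here, the shape all consumers use), `f` PRIME with `constantCoeff f = 0` and `f ∉ (X₀)`, regular off the origin `v`; `𝔪 = (x̄ⱼ)`, `Y₁ = affineBlowup 𝔪`.
* §1 `π_eq_vertex_of_not_mem_regularLocus` (Stacks 02OS off `π₁⁻¹(v)`), `centre_ne_bot`, `exists_over_generic`;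
* §2 ★ `support_vanishingIdeal_over_vertex` (the `hsupp` binder), `vanishingIdeal_ne_bot`, ★ `comap_pullback_fst_vanishingIdeal_ne_bot` (the `h𝓚` binder) — for ANY `Z : Closeds Y₁`
  with `↑Z = (Reg Y₁)ᶜ`.
[cite: StacksProject, Tag 02OS; Tag 01J7] [cite: GortzWedhorn2020, Prop. 13.91 (2)]
-/

-- single-problem summit: the doubled namespace component is forced
set_option linter.dupNamespace false

noncomputable section

namespace Summit.ResolutionOfSingularities.ResolutionOfSingularities.Theorems.FInjectiveMacaulayfication.X2CubicFormSingularCentre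

open CategoryTheory AlgebraicGeometry TopologicalSpace IsLocalRing MvPolynomial
open Literature.AlgebraicGeometry.Resolution
open Summit.ResolutionOfSingularities.ResolutionOfSingularities.Theorems.FInjectiveMacaulayfication

variable (k : Type) [Field k]

/-! ## §1 Non-regular points of `Y₁ = Bl_𝔪 Y` lie over the vertex -/

/-- ★ **A non-regular point of `Bl_𝔪 Y` lies over the vertex** (any prime `f` without constant term, `Y` regular off `v`): off `π₁⁻¹(v)` the blow-up is an isomorphism
(Stacks 02OS over each `D(x̄ⱼ)`). [cite: StacksProject, Tag 02OS] -/
theorem π_eq_vertex_of_not_mem_regularLocus (f : MvPolynomial (Fin 5) k) (hf0 : constantCoeff f = 0)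
    (hoff : ∀ (P : Ideal (MvPolynomial (Fin 5) k ⧸ Ideal.span {f})) [P.IsPrime],
      ¬ Ideal.span (Set.range fun j : Fin 5 => Ideal.Quotient.mk (Ideal.span {f}) (X j)) ≤ P → IsRegularLocalRing (Localization.AtPrime P))
    (v : Spec (.of (MvPolynomial (Fin 5) k ⧸ Ideal.span {f})))
    (hv : v.asIdeal = Ideal.span (Set.range fun j : Fin 5 => Ideal.Quotient.mk (Ideal.span {f}) (X j)))
    (𝔪 : Ideal (MvPolynomial (Fin 5) k ⧸ Ideal.span {f})) (h𝔪 : 𝔪 = Ideal.span (Set.range fun j : Fin 5 => Ideal.Quotient.mk (Ideal.span {f}) (X j)))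
    (x₁ : ↥(affineBlowup 𝔪)) (hx₁ : x₁ ∉ Scheme.regularLocus (affineBlowup 𝔪)) :
    (affineBlowup.π 𝔪).base x₁ = v := by
  classical
  by_contra hne
  have hmax : 𝔪.IsMaximal := by
    rw [h𝔪]; exact DoublePointFermatCubicGerm.isMaximal_origin k f hf0
  have hnotle : ¬ 𝔪 ≤ ((affineBlowup.π 𝔪).base x₁).asIdeal := by
    intro hle
    apply hne
    apply PrimeSpectrum.ext
    rw [hv, ← h𝔪]
    exact (hmax.eq_of_le ((affineBlowup.π 𝔪).base x₁).isPrime.ne_top hle).symm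
  obtain ⟨j, hj⟩ : ∃ j : Fin 5, Ideal.Quotient.mk (Ideal.span {f}) (X j) ∉ ((affineBlowup.π 𝔪).base x₁).asIdeal := by
    by_contra hall
    push Not at hall
    exact hnotle (h𝔪.le.trans (Ideal.span_le.mpr (by rintro _ ⟨j, rfl⟩; exact hall j)))
  have hjm : Ideal.Quotient.mk (Ideal.span {f}) (X j) ∈ 𝔪 := h𝔪 ▸ Ideal.subset_span ⟨j, rfl⟩
  haveI := affineBlowup.isIso_morphismRestrict (I := 𝔪) (Ideal.Quotient.mk (Ideal.span {f}) (X j)) hjm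
  have hwU : (affineBlowup.π 𝔪).base x₁ ∈ PrimeSpectrum.basicOpen (Ideal.Quotient.mk (Ideal.span {f}) (X j)) :=
    (PrimeSpectrum.mem_basicOpen _ _).mpr hj
  have hwreg : (affineBlowup.π 𝔪).base x₁ ∈ Scheme.regularLocus (Spec (.of (MvPolynomial (Fin 5) k ⧸ Ideal.span {f}))) :=
    FermatCubicConeGerm.mem_regularLocus_Spec_of_isRegularLocalRing _ (hoff _ (h𝔪 ▸ hnotle))
  exact hx₁ ((mem_regularLocus_iff_of_isIso_morphismRestrict (affineBlowup.π 𝔪)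
    (PrimeSpectrum.basicOpen (Ideal.Quotient.mk (Ideal.span {f}) (X j))) x₁ hwU).mpr hwreg)

/-- `𝔪 ≠ ⊥` (`x̄₀ ≠ 0` since `f` is prime and `f ∉ (X₀)`). [folklore] -/
theorem centre_ne_bot (f : MvPolynomial (Fin 5) k) (hprime : Prime f) (hfX : f ∉ Ideal.span {(X 0 : MvPolynomial (Fin 5) k)})
    (𝔪 : Ideal (MvPolynomial (Fin 5) k ⧸ Ideal.span {f})) (h𝔪 : 𝔪 = Ideal.span (Set.range fun j : Fin 5 => Ideal.Quotient.mk (Ideal.span {f}) (X j))) :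
    𝔪 ≠ ⊥ := by
  have h0m : Ideal.Quotient.mk (Ideal.span {f}) (X 0) ∈ 𝔪 := h𝔪 ▸ Ideal.subset_span ⟨0, rfl⟩
  have h00 : Ideal.Quotient.mk (Ideal.span {f}) (X 0 : MvPolynomial (Fin 5) k) ≠ 0 := fun h0 =>
    PrimeTransfer.X_not_mem_span_of_isPrime ((Ideal.span_singleton_prime hprime.ne_zero).mpr hprime) hfX (Ideal.Quotient.eq_zero_iff_mem.mp h0)
  exact fun h0 => h00 (by rw [← Ideal.mem_bot, ← h0]; exact h0m)

/-- **A regular point of `Bl_𝔪 Y` over the generic point of `Y`** (the blow-up is surjective, Stacks 02OS). [cite: StacksProject, Tag 02OS] -/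
theorem exists_over_generic (f : MvPolynomial (Fin 5) k) (hprime : Prime f) (hf0 : constantCoeff f = 0) (hfX : f ∉ Ideal.span {(X 0 : MvPolynomial (Fin 5) k)})
    (hoff : ∀ (P : Ideal (MvPolynomial (Fin 5) k ⧸ Ideal.span {f})) [P.IsPrime],
      ¬ Ideal.span (Set.range fun j : Fin 5 => Ideal.Quotient.mk (Ideal.span {f}) (X j)) ≤ P → IsRegularLocalRing (Localization.AtPrime P))
    (v : Spec (.of (MvPolynomial (Fin 5) k ⧸ Ideal.span {f})))
    (hv : v.asIdeal = Ideal.span (Set.range fun j : Fin 5 => Ideal.Quotient.mk (Ideal.span {f}) (X j)))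
    (𝔪 : Ideal (MvPolynomial (Fin 5) k ⧸ Ideal.span {f})) (h𝔪 : 𝔪 = Ideal.span (Set.range fun j : Fin 5 => Ideal.Quotient.mk (Ideal.span {f}) (X j))) :
    ∃ x₁ : ↥(affineBlowup 𝔪), (affineBlowup.π 𝔪).base x₁ ⤳ v ∧ (affineBlowup.π 𝔪).base x₁ ≠ v ∧ x₁ ∈ Scheme.regularLocus (affineBlowup 𝔪) := by
  classical
  haveI hfprime : (Ideal.span {f}).IsPrime := (Ideal.span_singleton_prime hprime.ne_zero).mpr hprime
  haveI : IsDomain (MvPolynomial (Fin 5) k ⧸ Ideal.span {f}) := Ideal.Quotient.isDomain _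
  have h𝔪ne : 𝔪 ≠ ⊥ := centre_ne_bot k f hprime hfX 𝔪 h𝔪
  let η : Spec (.of (MvPolynomial (Fin 5) k ⧸ Ideal.span {f})) := ⟨⊥, Ideal.isPrime_bot⟩
  obtain ⟨x₁, hx₁⟩ := affineBlowup.surjective h𝔪ne η
  have hηv : η ⤳ v := (PrimeSpectrum.le_iff_specializes η v).mp bot_le
  have hηne : η ≠ v := by
    intro h
    have : (v.asIdeal : Ideal _) = ⊥ := by rw [← h]
    rw [hv, ← h𝔪] at this
    exact h𝔪ne this
  refine ⟨x₁, by rw [hx₁]; exact hηv, by rw [hx₁]; exact hηne, ?_⟩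
  by_contra hreg
  exact hηne (hx₁ ▸ π_eq_vertex_of_not_mem_regularLocus k f hf0 hoff v hv 𝔪 h𝔪 x₁ hreg)

/-! ## §2 The singular centre: support over the vertex, non-vanishing on the local model -/

/-- ★ **`hsupp`**: every point of the support of `vanishingIdeal Z` (`↑Z = (Reg Y₁)ᶜ`) lies over the vertex. [cite: StacksProject, Tag 02OS] -/
theorem support_vanishingIdeal_over_vertex (f : MvPolynomial (Fin 5) k) (hf0 : constantCoeff f = 0)
    (hoff : ∀ (P : Ideal (MvPolynomial (Fin 5) k ⧸ Ideal.span {f})) [P.IsPrime],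
      ¬ Ideal.span (Set.range fun j : Fin 5 => Ideal.Quotient.mk (Ideal.span {f}) (X j)) ≤ P → IsRegularLocalRing (Localization.AtPrime P))
    (v : Spec (.of (MvPolynomial (Fin 5) k ⧸ Ideal.span {f})))
    (hv : v.asIdeal = Ideal.span (Set.range fun j : Fin 5 => Ideal.Quotient.mk (Ideal.span {f}) (X j)))
    (𝔪 : Ideal (MvPolynomial (Fin 5) k ⧸ Ideal.span {f})) (h𝔪 : 𝔪 = Ideal.span (Set.range fun j : Fin 5 => Ideal.Quotient.mk (Ideal.span {f}) (X j)))
    (Z : Closeds ↥(affineBlowup 𝔪)) (hZ : (Z : Set ↥(affineBlowup 𝔪)) = (Scheme.regularLocus (affineBlowup 𝔪))ᶜ) :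
    ∀ x₁ ∈ ((Scheme.IdealSheafData.vanishingIdeal Z).support : Set ↥(affineBlowup 𝔪)),
      (affineBlowup.π 𝔪).base x₁ ⤳ v → (affineBlowup.π 𝔪).base x₁ = v := by
  intro x₁ hx₁ _
  rw [Scheme.IdealSheafData.coe_support_vanishingIdeal, hZ] at hx₁
  exact π_eq_vertex_of_not_mem_regularLocus k f hf0 hoff v hv 𝔪 h𝔪 x₁ hx₁

/-- **`vanishingIdeal Z ≠ ⊥`** (a regular point exists over the generic point). [folklore] -/
theorem vanishingIdeal_ne_bot (f : MvPolynomial (Fin 5) k) (hprime : Prime f) (hf0 : constantCoeff f = 0) (hfX : f ∉ Ideal.span {(X 0 : MvPolynomial (Fin 5) k)})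
    (hoff : ∀ (P : Ideal (MvPolynomial (Fin 5) k ⧸ Ideal.span {f})) [P.IsPrime],
      ¬ Ideal.span (Set.range fun j : Fin 5 => Ideal.Quotient.mk (Ideal.span {f}) (X j)) ≤ P → IsRegularLocalRing (Localization.AtPrime P))
    (v : Spec (.of (MvPolynomial (Fin 5) k ⧸ Ideal.span {f})))
    (hv : v.asIdeal = Ideal.span (Set.range fun j : Fin 5 => Ideal.Quotient.mk (Ideal.span {f}) (X j)))
    (𝔪 : Ideal (MvPolynomial (Fin 5) k ⧸ Ideal.span {f})) (h𝔪 : 𝔪 = Ideal.span (Set.range fun j : Fin 5 => Ideal.Quotient.mk (Ideal.span {f}) (X j)))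
    (Z : Closeds ↥(affineBlowup 𝔪)) (hZ : (Z : Set ↥(affineBlowup 𝔪)) = (Scheme.regularLocus (affineBlowup 𝔪))ᶜ) :
    Scheme.IdealSheafData.vanishingIdeal Z ≠ ⊥ := by
  intro h0
  obtain ⟨x₁, -, -, hreg⟩ := exists_over_generic k f hprime hf0 hfX hoff v hv 𝔪 h𝔪
  have hsupp := Scheme.IdealSheafData.coe_support_vanishingIdeal Z
  rw [h0, Scheme.IdealSheafData.support_bot, hZ] at hsupp
  have : x₁ ∈ (Scheme.regularLocus (affineBlowup 𝔪))ᶜ := by rw [← hsupp]; simp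
  exact this hreg

/-- ★ **`h𝓚`**: the singular centre does not vanish on the local model `Y₁ ×_Y Spec 𝒪_{Y,v}`. [cite: GortzWedhorn2020, Prop. 13.91 (2)] [cite: StacksProject, Tag 01J7] -/
theorem comap_pullback_fst_vanishingIdeal_ne_bot (f : MvPolynomial (Fin 5) k) (hprime : Prime f) (hf0 : constantCoeff f = 0)
    (hfX : f ∉ Ideal.span {(X 0 : MvPolynomial (Fin 5) k)})
    (hoff : ∀ (P : Ideal (MvPolynomial (Fin 5) k ⧸ Ideal.span {f})) [P.IsPrime],
      ¬ Ideal.span (Set.range fun j : Fin 5 => Ideal.Quotient.mk (Ideal.span {f}) (X j)) ≤ P → IsRegularLocalRing (Localization.AtPrime P))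
    (v : Spec (.of (MvPolynomial (Fin 5) k ⧸ Ideal.span {f})))
    (hv : v.asIdeal = Ideal.span (Set.range fun j : Fin 5 => Ideal.Quotient.mk (Ideal.span {f}) (X j)))
    (𝔪 : Ideal (MvPolynomial (Fin 5) k ⧸ Ideal.span {f})) (h𝔪 : 𝔪 = Ideal.span (Set.range fun j : Fin 5 => Ideal.Quotient.mk (Ideal.span {f}) (X j)))
    (Z : Closeds ↥(affineBlowup 𝔪)) (hZ : (Z : Set ↥(affineBlowup 𝔪)) = (Scheme.regularLocus (affineBlowup 𝔪))ᶜ) :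
    (Scheme.IdealSheafData.vanishingIdeal Z).comap
      (Limits.pullback.fst (affineBlowup.π 𝔪) ((Spec (.of (MvPolynomial (Fin 5) k ⧸ Ideal.span {f}))).fromSpecStalk v)) ≠ ⊥ := by
  intro h0
  obtain ⟨x₁, hgen, hne, hreg⟩ := exists_over_generic k f hprime hf0 hfX hoff v hv 𝔪 h𝔪
  have hmem : x₁ ∈ Set.range (Limits.pullback.fst (affineBlowup.π 𝔪) ((Spec (.of (MvPolynomial (Fin 5) k ⧸ Ideal.span {f}))).fromSpecStalk v)) := by
    rw [range_pullback_fst_fromSpecStalk]; exact hgen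
  obtain ⟨t, rfl⟩ := hmem
  have ht : t ∈ ((((Scheme.IdealSheafData.vanishingIdeal Z).comap
      (Limits.pullback.fst (affineBlowup.π 𝔪) ((Spec (.of (MvPolynomial (Fin 5) k ⧸ Ideal.span {f}))).fromSpecStalk v))).support : Set _)) := by
    rw [h0, Scheme.IdealSheafData.support_bot]; simp
  rw [Scheme.IdealSheafData.support_comap] at ht
  have ht' : (Limits.pullback.fst (affineBlowup.π 𝔪) ((Spec (.of (MvPolynomial (Fin 5) k ⧸ Ideal.span {f}))).fromSpecStalk v)).base t ∈
      ((Scheme.IdealSheafData.vanishingIdeal Z).support : Set _) := ht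
  rw [Scheme.IdealSheafData.coe_support_vanishingIdeal, hZ] at ht'
  exact ht' hreg

end Summit.ResolutionOfSingularities.ResolutionOfSingularities.Theorems.FInjectiveMacaulayfication.X2CubicFormSingularCentre

end
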